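/-
Origin: expansion seat `planner-pub-hodgecm-prl1-g5-0`, handover #5 2026-08-18T09:32:15Z (`HOME/pub-hodgecm-prl1-g5/lean/Prl1g5/SignRecipeEndStateFree.lean`, md5 b2f93d4a, 74 lines);
landed by the gen-7 packager in gate run 27 as `HodgeCM/Automorphic/SignRecipeEndStateFree.lean` (import ^import Prl1g5\.→import HodgeCM.Automorphic. ×1; import ^import Pv10g3\.→import HodgeCM.PerL34. ×1).
-/
/-
Origin: HOME/pub-hodgecm-prl1-g5/lean/Prl1g5/SignRecipeEndStateFree.lean — session planner-pub-hodgecm-prl1-g5-0 (unit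
pub-hodgecm-prl1-g5, EXPANSION PROVER a-1 gen 5, STRATEGY 1 = CONSTRUCT).  Intended final place:
`HodgeCM/Automorphic/SignRecipeEndStateFree.lean`.  Imports at landing: `Prl1g5.SignRecipeEndState` ↦
`HodgeCM.Automorphic.SignRecipeEndState` (this seat's #2) and `Pv10g3.GodementCompact` ↦ `HodgeCM.PerL34.GodementCompact`
(pv10-g3 #5: `HodgeCM.printFact_unitaryCompact_holds`, KERNEL); lands after both.
-/
import Summits.HodgeConjecture.HodgeCM.Automorphic.SignRecipeEndState
import Summits.HodgeConjecture.HodgeCM.PerL34.GodementCompact_2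

/-!
# END STATE of part (a): sign recipe CONSTRUCTED and compactness criterion PROVED — the binder-minimal form

`Assembly.realisationExists_ofSignRecipe₀ (M) (h) (C : U.AdelicThetaCore₀) (d12 d34) (A : NonDesignInputs) (hHR) :
U.RealisationExistsPerL ∧ U.RealisationExistsFace` = this seat's `realisationExists_ofSignRecipe` (#2) at
`hP := HodgeCM.printFact_unitaryCompact_holds` (pv10-g3, Mahler's criterion + Godement's argument, kernel).

Remaining hypotheses of the realisation cone (honest census, nothing hidden in definitions): the universe model facts
`M : U.ModelAxioms`; PerL's convention bit `h : Bool` (`φ^h ∈ {1, c}`, (eq:Phiprime) l. 100); the uniformisation DATA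
`C = (emb, cover, wm, Theta)` over the GENUINE adelic unitary groups with their PROVED-compact quotients; per context the
torus-side DATA `d12 c, d34 c : SideData` (archimedean types + Def 3.2 predicate); the EIGHT non-design theta inputs
(PRINT `embCover`, `innerEmb`; OPEN `thetaSub` N12, `thetaWedge` N33, `thetaGen12` N19w, `thetaReal34` N19g, `chars` N31,
`occ` N29); Hodge–Riemann `hHR`.  GONE versus prl1-g4's run-27 END STATE: `hP` (proved), `kappa`, `frameSign` (constructed),
`kappaConj`, `frameSignConj` (proved).
-/

noncomputable section

namespace HodgeCM

namespace Universe

variable (U : Universe)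

/-- The core DATA over the hypothesis-free compact models (`hP := printFact_unitaryCompact_holds`). -/
abbrev AdelicThetaCore₀ : Type _ := U.AdelicThetaCore printFact_unitaryCompact_holds

end Universe

namespace Assembly

open HodgeCM.PerL34
open HodgeCM.Prior.Perl34File HodgeCM.Prior.Perl34File.Perl34
open HodgeCM.Universe (AdelicThetaCore AdelicThetaCore₀ SideData ThetaModel)

variable (U : Universe)

/-- **Both realisation inputs of part (a), binder-minimal END STATE**: model facts, the bit `h`, uniformisation DATA,
torus-side DATA, the eight non-design theta inputs, Hodge–Riemann — and NOTHING ELSE (no `hP`, no sign data, no design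
input). -/
theorem realisationExists_ofSignRecipe₀ (M : U.ModelAxioms) (h : Bool) (C : U.AdelicThetaCore₀)
    (d12 d34 : ∀ {L : CMField}, SeesawCtx L → SideData L)
    (A : (C.thetaModel h d12 d34).NonDesignInputs) (hHR : U.Fact_hodgeRiemann20) :
    U.RealisationExistsPerL ∧ U.RealisationExistsFace :=
  realisationExists_ofSignRecipe U M printFact_unitaryCompact_holds h C d12 d34 A hHR

/-- **PerL, binder-minimal END STATE.** -/
theorem perL_ofSignRecipe₀ (M : U.ModelAxioms) (h : Bool) (C : U.AdelicThetaCore₀)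
    (d12 d34 : ∀ {L : CMField}, SeesawCtx L → SideData L)
    (A : (C.thetaModel h d12 d34).NonDesignInputs) (hHR : U.Fact_hodgeRiemann20) : U.PerL :=
  perL_ofSignRecipe U M printFact_unitaryCompact_holds h C d12 d34 A hHR

/-- **COR-CM, binder-minimal END STATE.** -/
theorem COR_CM_endState_ofSignRecipe₀ (M : U.ModelAxioms) (h29 : U.Fact_weightSpan)
    (h30 : U.Fact_weightHodge) (hE : U.Qw8ExtProd) (hD : U.Qw8DualPushPull) (hMi : U.Qw8Milne) (h : Bool)
    (C : U.AdelicThetaCore₀) (d12 d34 : ∀ {L : CMField}, SeesawCtx L → SideData L)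
    (A : (C.thetaModel h d12 d34).NonDesignInputs) (hHR : U.Fact_hodgeRiemann20) : U.HC_CM :=
  COR_CM_endState_ofSignRecipe U M h29 h30 hE hD hMi printFact_unitaryCompact_holds h C d12 d34 A hHR

end Assembly

end HodgeCM

end
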